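import Summits.ABC.IUTFork.Conditional.WRowLicenceSocketMOfK
import Summits.ABC.IUTFork.Conditional.WRowFrey283Packages
import Summits.ABC.IUTFork.Conditional.WRowUnconditionalPackages
import Summits.ABC.IUTFork.Conditional.AbcOfSGenuineKTameShallowInhabitedThirtyRows
import Summits.ABC.IUTFork.Conditional.AbcOfSGenuineKTameShallowInhabitedTwoRows
import Summits.ABC.IUTFork.Cor312GenuineKLocalTypeThirty
import HarnessLib

/-!
# Branch C / R-W, reading (U), M line: the M-SETTING licence at the TAME SHALLOW triples — every bad prime `p ≥ 30·l + 2` with `p³ ∤ abc` —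
# and the M twins of the five tame-shallow CHOSEN rows of the R-W table (`1+1372=1373`, `1+448=449`, `1+256=257`, `8+185753=185761` at
# `l = 7`; `1+2662=2663` at `l = 11`)
# (abc-iut cell, branch C, row «C:INH-M-TWIN-RESIDUE»; seat abc-iut-C-cert-2 gen 8; C LEAD KEY 2026-08-27T13:11Z; work list abc-iut-rw-num-lead's
# `plan/rescue/R-W/M-TWIN-GAP-INH.tsv`, rows `GenuineK.pilotKummerCompatHull_chosen_triple_{1_1372_1373,1_448_449,1_256_257,8_185753_185761}_seven`,
# `…_1_2662_2663_eleven`)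

Record-only PROOF file (D-0012; 0 definitions, 0 `Prop` facts, nothing re-typed) of the abc-iut cell. TAKES NO SIDE on [IUTchIII] Cor. 3.12
(S. Mochizuki, *Inter-universal Teichmüller theory III*, Cor. 3.12 p. 173–174; Step (xi-f) p. 184) or on any author; «inhabited as typed» ≠
«asserted in print».

The K line's tame-shallow rows (abc-iut-w5-d009 lineage: `GenuineK.pilotKummerCompatHull_chosen_triple_of_tame_shallow[_two|_thirty]`,
`AbcOfSGenuineKTameShallowInhabited*`) run through the TAME-PAIRS decider `licence_settingPrVolSharp_pilotDataOfK_iff_of_tame_pairs` at the CHOSEN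
realising ideles, which has no M counterpart. HERE the M licence at such triples is obtained from this seat's K→M TRANSFER SOCKET
`WRowM.licence_tOfIdeleData_of_ordersK_rat` (`WRowLicenceSocketMOfK`, gen 8) with the TAME packages of the W lane at every bad K-fibre point
`x ∣ p` (all BY NAME): index `e = e(K_x/ℚ_p)` (constant over the fibre at `d_mod = 1`, `WRow.absRamificationIdx_kOf_eq_of_finrank_eq_one`) with
`e ∣ 30·l`, hence `e ≤ 30 l < p − 1` (abc-iut-W-neg-2's `GenuineK.absRamificationIdx_kOf_dvd_thirty_mul_ratPoint`) and `l ∣ e`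
(`GenuineK.prime_dvd_absRamificationIdx_kOf_ratPoint`); different `D = e − 1` (`Cor312Prov.pred_div_le_differentOrd_of_eq`); inner witness `ρin = 1`
(`WRow.inner_witness_trivial`); outer member `ρout = 1` (`WRow.outer_member_min` with exponents `0, 0`; `e ≠ p^k(p−1)` since `e < p − 1`); pole
`ord_p j(a/c) = −2·v_p(abc)` (`Cor22.ord_jInv_ratPoint_triple_eq`), `v_p(abc) ∈ {1, 2}`. The integer cell at label `j = i + 1 ≤ (l−1)/2` then reads,
with `e = l·m`, `P = m·v`: `e·⌊(j²mv − j(e−1) − (j+1))/e⌋ + (j+1) ≤ (j²mv − j·l·m + j) ≤ j(1 − m) ≤ 0 ≤ P` because `j·v ≤ 2j ≤ l − 1` — three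
lines of `linarith` after `Int.ediv_mul_le`; no table, no `decide`.

* **`WRowM.licence_triple_of_tame_shallow`** — `a + b = c` an abc triple, every prime `p ∣ abc` with `p ≠ 2, l` satisfying `30·l + 2 ≤ p` and
  `p³ ∤ abc` (this covers the K rows' hypotheses `60·l + 2 ≤ p ∧ p² ∤ abc`, `… ∧ p³ ∤ abc` and `30·l + 2 ≤ p ∧ p³ ∤ abc`) ⟹ for EVERY genuine
  Θ-volume datum `T` at `(ratPoint (a/c), l)` and EVERY idele datum `r` of `T.D`: `Thm311ToCor312.Licence` at
  `settingPrVolSharpM T.D hlog (tOfIdeleData T.D r) (tqM … r …) …` (every analytic `logvK`, any `htq0/Sq/htq1`);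
* **`WRowM.licence_triple_1_1372_1373_seven_M`**, **`…_1_448_449_seven_M`**, **`…_1_256_257_seven_M`**, **`…_8_185753_185761_seven_M`**,
  **`…_1_2662_2663_eleven_M`** — the five rows, the K files' prime-divisor discharges VERBATIM (`isABCTriple_…`, `prime_…` BY NAME).

READING (neutral): the M books' (U) binder (S_H,M / NUM-M antecedents at `settingPrVolSharpM … (tOfIdeleData …) (tqM …) …`) is INHABITED AS TYPED at
every genuine datum over these five Frey points at the listed levels — positive-instance rows; the K rows state the hull at the CHOSEN ideles and
the analytic logarithms, the M statement is for every own-idele datum `r` and every analytic `logvK` (the M setting realises by construction).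
HONEST SCOPE: OUR sharp containers and Dupuy–Hilado's typed (Ind1)/(Ind2); STRONGER-THAN-PRINT hull reading; a socket discharges nothing;
non-emptiness of the datum type, admissibility and Szpiro-badness NOT claimed; explicit hypothesis counts of the record books UNCHANGED; an M
twin changes NO K-line census count; nothing about the printed GLOBAL inequality or the number-level corollary; typed ≠ proved; instantiated ≠
endorsed; no abc claim. [cite: Mochizuki2012, IUTchI Def. 3.1 (b),(c) pp. 61–62, Rmk. 3.1.5 p. 65, Ex. 3.2 (iv) p. 71; IUTchIII Cor. 3.12
Step (xi-f) p. 184; IUTchIV Prop. 1.1 p. 9, Prop. 1.2 (i)(ii) p. 10, Prop. 1.4 (ii) p. 13, Cor. 2.2 (ii) proof (P5) p. 46]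
[cite: DupuyHilado2025, §3.3, §3.4, §4.9, §4.12] [cite: NeukirchANT1999, Ch. II (5.5)–(5.7)] [cite: SilvermanAEC2009, Prop. III.1.7(b)]
[cite: SilvermanATAEC1994, V.5 Thm. 5.3 and Cor. 5.4] [claim: Mochizuki2012, status: disputed] for every IUT sentence. PROOF-ONLY: no definitions.
-/

noncomputable section

open Set Function Metric NumberField IsDedekindDomain

namespace Summit.ABC.IUTFork.Conditional

open Thm311 Thm311.Real Cor312 Cor312Vol Cor312Prov Literature.IUT.LogThetaLattice Literature.IUT.LogVolume
  Literature.IUT.HodgeTheaters Literature.IUT.LogVolume.Cor22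
open Literature.NumberTheory.NumberFields Literature.NumberTheory.GaloisRepresentations.Ultrametric
open Literature.NumberTheory.DiophantineGeometry Literature.NumberTheory.DiophantineGeometry.GenEll

/-- **THE M-LEVEL LICENCE AT A TAME SHALLOW TRIPLE.** `a + b = c` an abc triple such that every prime `p ∣ abc` other than `2` and the level `l`
has `30·l + 2 ≤ p` and `p³ ∤ abc`; `T` ANY genuine Θ-volume datum at `(ratPoint (a/c), l)`; `r` ANY idele datum of `T.D` ⟹ abc-iut-c312-1's
`Thm311ToCor312.Licence` at `settingPrVolSharpM T.D hlog (tOfIdeleData T.D r) (tqM … r …) …` (every analytic `logvK`, every context datum, any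
`htq0/Sq/htq1`). Proof: this seat's K→M transfer socket `WRowM.licence_tOfIdeleData_of_ordersK_rat` fed with the W lane's TAME packages at every bad
K-fibre point (`e ∣ 30l`, `l ∣ e`, `D = e − 1`, `ρin = ρout = 1`, `ord_p j = −2v_p`, `v_p ∈ {1,2}`) and the three-line cell estimate
`e·⌊(j²mv − j(e−1) − (j+1))/e⌋ + (j+1) ≤ j(1 − m) ≤ 0 ≤ mv` (`e = lm`, `jv ≤ l − 1`).
[cite: Mochizuki2012, IUTchI Def. 3.1 (b),(c) pp. 61–62, Ex. 3.2 (iv) p. 71; IUTchIII Cor. 3.12 Step (xi-f) p. 184; IUTchIV Prop. 1.1 p. 9, Prop. 1.2 (i)(ii)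
p. 10, Prop. 1.4 (ii) p. 13, Cor. 2.2 (ii) proof (P5) p. 46] [cite: DupuyHilado2025, §3.3, §3.4, §4.9, §4.12] [cite: SilvermanAEC2009, Prop. III.1.7(b)]
[claim: Mochizuki2012, status: disputed] -/
theorem WRowM.licence_triple_of_tame_shallow {a b c l : ℕ} (habc : IsABCTriple a b c)
    (hprimes : ∀ p : ℕ, p.Prime → p ∣ a * b * c → p ≠ 2 → p ≠ l → 30 * l + 2 ≤ p ∧ ¬ p ^ 3 ∣ a * b * c)
    (T : Cor22.ThetaVolumeDatumAt (ratPoint ((a : ℚ) / c)) l) :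
    letI := T.instFieldF; letI := T.instNumberFieldF; letI := T.instAlgebraF; letI := T.instFieldK
    letI := T.instNumberFieldK; letI := T.instAlgebraK; letI := T.instFieldFbar; letI := T.instAlgebraFbar
    letI := T.instAlgebraKFbar; letI := T.instIsElliptic
    ∀ {logvK : PadicLogsVal T.K} (hlog : LogvAnalyticVal logvK) (r : ThetaData.IdeleData T.D) (M : Type) [Field M] [NumberField M]
      (archPk : ∀ (j : (thetaIndexOfInitial T.D).Label) (vQ : (thetaIndexOfInitial T.D).VQ),
        Set ((logShellsOfInitialDH T.D logvK).Packet j vQ))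
      (archSub : ∀ (j : (thetaIndexOfInitial T.D).Label) (v : (thetaIndexOfInitial T.D).V),
        Set ((logShellsOfInitialDH T.D logvK).Packet j ((thetaIndexOfInitial T.D).over v)))
      (Ψ : ℤ → ∀ v : (thetaIndexOfInitial T.D).V, v ∈ (thetaIndexOfInitial T.D).Vbad →
        Set ((logShellsOfInitialDH T.D logvK).StarPacket v))
      (act : ℤ → ∀ v : (thetaIndexOfInitial T.D).V, v ∈ (thetaIndexOfInitial T.D).Vbad →
        (logShellsOfInitialDH T.D logvK).StarPacket v → Module.End ℚ ((logShellsOfInitialDH T.D logvK).StarPacket v))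
      (Mmod : ℤ → ∀ j : (thetaIndexOfInitial T.D).LabelStar, Set ((logShellsOfInitialDH T.D logvK).GlobalPacket j.1))
      (region : ℤ → ∀ j : (thetaIndexOfInitial T.D).LabelStar, FinDivisor M → ∀ vQ : (thetaIndexOfInitial T.D).VQ,
        Set ((logShellsOfInitialDH T.D logvK).Packet j.1 vQ))
      (n : ℤ) {HT : Type} {LogLink : HT → HT → Type} {IsFull : ∀ {s t : HT}, LogLink s t → Prop}
      (lat : LGPGaussianLogThetaLattice LogLink IsFull)
      {Frd : Type} {IsoF : Frd → Frd → Type} {Ob : Frd → Type} {realify : Frd → Frd} {Strip : Type}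
      {IsoS : Strip → Strip → Type}
      {Mv : ∀ v : (thetaIndexOfInitial T.D).V, v ∈ (thetaIndexOfInitial T.D).Vbad → Type} [∀ v h, Monoid (Mv v h)]
      (sig : GlobalLGPFrobenioidSignature (thetaIndexOfInitial T.D).lstar (thetaIndexOfInitial T.D).V
        (· ∈ (thetaIndexOfInitial T.D).Vbad) Frd IsoF Ob realify Strip IsoS Mv)
      (split : SplittingMonoids Mv) {ObΔ : Type}
      {N : ∀ v : (thetaIndexOfInitial T.D).V, v ∈ (thetaIndexOfInitial T.D).Vbad → Type} [∀ v h, Monoid (N v h)]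
      (qData : QPilotData ObΔ N)
      (htq0 : ∀ (u : FinitePlace ℚ) (x : (thetaIndexOfInitial T.D).Fibre (Val.non u)),
        tqM T.D (ratChar u) u (natCast_ratChar_mem u) r x ≠ 0)
      (Sq : Finset (FinitePlace ℚ))
      (htq1 : ∀ (u : FinitePlace ℚ) (x : (thetaIndexOfInitial T.D).Fibre (Val.non u)), u ∉ Sq →
        ‖tqM T.D (ratChar u) u (natCast_ratChar_mem u) r x‖ = 1),
      Thm311ToCor312.Licence
        (settingPrVolSharpM T.D hlog (tOfIdeleData T.D r) (fun u x => tqM T.D (ratChar u) u (natCast_ratChar_mem u) r x) M archPk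
          archSub Ψ act Mmod region n lat sig split qData htq0 Sq htq1) := by
  classical
  letI := T.instFieldF; letI := T.instNumberFieldF; letI := T.instAlgebraF; letI := T.instFieldK
  letI := T.instNumberFieldK; letI := T.instAlgebraK; letI := T.instFieldFbar; letI := T.instAlgebraFbar
  letI := T.instAlgebraKFbar; letI := T.instIsElliptic
  intro logvK hlog r M _ _ archPk archSub Ψ act Mmod region n HT LogLink IsFull lat Frd IsoF Ob realify Strip IsoS Mv _ sig split ObΔ N _
    qData htq0 Sq htq1
  have hjF : T.E.j = ((jInv ((a : ℚ) / c) : ℚ) : T.F) := by rw [T.j_eq]; exact eq_ratCast _ _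
  have hl5 : 5 ≤ l := T.D.five_le_l
  have hlstar : (pilotDataOfK T.D T.K).lstar = (l - 1) / 2 := by
    show ((pilotDataOfK T.D T.K).l - 1) / 2 = (l - 1) / 2
    rw [pilotDataOfK_l]
  have ha : 0 < a := habc.1
  have hb : 0 < b := habc.2.1
  have hc : 0 < c := by have := habc.2.2.1; omega
  have habc0 : a * b * c ≠ 0 := by positivity
  -- `d_mod = 1`: the index is constant over the bad fibre
  have hFm : Module.finrank ℚ (fieldOfModuli T.E) = 1 := by
    rw [T.finrank_rat_fieldOfModuli_eq_dmod]
    exact dmod_eq_one_of_degree_le_one (by rw [degree_ratPoint])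
  set X := pilotDataOfK T.D T.K with hX
  set eF : Nat.Primes → ℕ := fun pp =>
    haveI : Fact (pp : ℕ).Prime := ⟨pp.2⟩
    if h : ∃ x : (thetaIndex X).Fibre (.inr pp), placeOf X pp.1 x ∈ X.S
    then absRamificationIdx (pp : ℕ) (kOf X pp.1 h.choose) else 1 with heF
  have heq : ∀ (pp : Nat.Primes) (x : (thetaIndex X).Fibre (.inr pp)),
      haveI : Fact (pp : ℕ).Prime := ⟨pp.2⟩
      placeOf X pp.1 x ∈ X.S → absRamificationIdx (pp : ℕ) (kOf X pp.1 x) = eF pp := by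
    intro pp x hx
    haveI : Fact (pp : ℕ).Prime := ⟨pp.2⟩
    have hex : ∃ x : (thetaIndex X).Fibre (.inr pp), placeOf X pp.1 x ∈ X.S := ⟨x, hx⟩
    have h1 : eF pp = absRamificationIdx (pp : ℕ) (kOf X pp.1 hex.choose) := by
      simp only [heF, dif_pos hex]
    rw [h1]
    exact WRow.absRamificationIdx_kOf_eq_of_finrank_eq_one T.D hFm pp x hex.choose
  -- everything the tree knows at a bad fibre point of a tame shallow triple
  have hfacts : ∀ (pp : Nat.Primes) (x : (thetaIndex X).Fibre (.inr pp)),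
      haveI : Fact (pp : ℕ).Prime := ⟨pp.2⟩
      placeOf X pp.1 x ∈ X.S →
        (pp : ℕ) ∣ a * b * c ∧ (pp : ℕ) ≠ 2 ∧ (pp : ℕ) ≠ l ∧ 30 * l + 2 ≤ (pp : ℕ) ∧
        1 ≤ (a * b * c).factorization pp ∧ (a * b * c).factorization pp ≤ 2 ∧
        (∀ v : HeightOneSpectrum (𝓞 ℚ), Rat.HeightOneSpectrum.natGenerator v = pp →
          ord ℚ v (jInv ((a : ℚ) / c)) = -(2 * (((a * b * c).factorization pp : ℕ) : ℤ))) ∧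
        0 < eF pp ∧ l ∣ eF pp ∧ eF pp ∣ 30 * l := by
    intro pp x hx
    haveI : Fact (pp : ℕ).Prime := ⟨pp.2⟩
    have hE := heq pp x hx
    have hdvd : (pp : ℕ) ∣ a * b * c := Cor312Prov.natCast_dvd_of_placeOf_mem_S_triple T.D habc hjF pp x hx
    obtain ⟨h2, hl⟩ := ne_two_and_ne_l_of_placeOf_mem_S_pilotDataOfK T.D pp x hx
    obtain ⟨h30, hcube⟩ := hprimes pp pp.2 hdvd h2 hl
    have hv1 : 1 ≤ (a * b * c).factorization pp := Nat.Prime.factorization_pos_of_dvd pp.2 habc0 hdvd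
    have hv2 : (a * b * c).factorization pp ≤ 2 := by
      by_contra hgt
      exact hcube ((Nat.Prime.pow_dvd_iff_le_factorization pp.2 habc0).mpr (by omega))
    have hpole : ∀ v : HeightOneSpectrum (𝓞 ℚ), Rat.HeightOneSpectrum.natGenerator v = pp →
        ord ℚ v (jInv ((a : ℚ) / c)) = -(2 * (((a * b * c).factorization pp : ℕ) : ℤ)) := by
      intro v hv'
      rw [Cor22.ord_jInv_ratPoint_triple_eq habc v (by rw [hv']; exact h2) (by rw [hv']; exact hdvd), hv']
    have hpole' : ∀ v : HeightOneSpectrum (𝓞 ℚ), Rat.HeightOneSpectrum.natGenerator v = pp →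
        ord ℚ v (jInv ((a : ℚ) / c)) < 0 := by
      intro v hv'
      rw [hpole v hv']
      have : (0 : ℤ) < (a * b * c).factorization pp := by exact_mod_cast hv1
      linarith
    have hpos := absRamificationIdx_pos (pp : ℕ) (kOf X pp.1 x)
    have hle := GenuineK.prime_dvd_absRamificationIdx_kOf_ratPoint T pp h2 hl hpole' x
    have h3 : (pp : ℕ) ≠ 3 := by omega
    have h5 : (pp : ℕ) ≠ 5 := by omega
    obtain ⟨h30e, -⟩ := GenuineK.absRamificationIdx_kOf_dvd_thirty_mul_ratPoint T pp h2 h3 h5 hl hpole' x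
    rw [hE] at hpos hle h30e
    exact ⟨hdvd, h2, hl, h30, hv1, hv2, hpole, hpos, hle, h30e⟩
  refine WRowM.licence_tOfIdeleData_of_ordersK_rat T.D hlog r M archPk archSub Ψ act Mmod region n lat sig split qData htq0 Sq htq1
    (jInv ((a : ℚ) / c)) hjF eF (fun pp => eF pp - 1) (fun pp => 2 * (a * b * c).factorization pp) (fun _ => 1) (fun _ => 1)
    (fun pp x hx => ?_) (fun pp hpp i => ?_)
  · -- the TAME package at a bad place `x | p`
    haveI : Fact (pp : ℕ).Prime := ⟨pp.2⟩
    have hE := heq pp x hx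
    obtain ⟨hdvd, h2, hl, h30, hv1, hv2, hpole, hpos, hle, h30e⟩ := hfacts pp x hx
    have he30 : eF pp ≤ 30 * l := Nat.le_of_dvd (by omega) h30e
    -- `e < p − 1`, so `e` is not a cyclotomic index `p^k (p − 1)`
    have hne : ∀ k : ℕ, (eF pp : ℤ) ≠ ((pp : ℕ) : ℤ) ^ k * (((pp : ℕ) : ℤ) - 1) := by
      intro k hk
      have hp1 : (1 : ℤ) ≤ ((pp : ℕ) : ℤ) := by exact_mod_cast pp.2.one_lt.le
      have hpk : (1 : ℤ) ≤ ((pp : ℕ) : ℤ) ^ k := one_le_pow₀ hp1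
      have h1 : ((pp : ℕ) : ℤ) - 1 ≤ ((pp : ℕ) : ℤ) ^ k * (((pp : ℕ) : ℤ) - 1) :=
        le_mul_of_one_le_left (by linarith) hpk
      have h2' : (eF pp : ℤ) ≤ 30 * l := by exact_mod_cast he30
      have h3' : (30 * l + 2 : ℤ) ≤ ((pp : ℕ) : ℤ) := by exact_mod_cast h30
      linarith
    refine ⟨hE, ?_, ?_, ?_, ?_, ?_⟩
    · exact Cor312Prov.pred_div_le_differentOrd_of_eq (pp : ℕ) hE
    · exact WRow.inner_witness_trivial (pp : ℕ) _ (eF pp)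
    · exact WRow.outer_member_min (pp : ℕ) hE hne 0 0 rfl (by simp)
    · rw [hpole _ (natGenerator_finBelow_placeOf T.D pp x)]
      push_cast
      ring
    · obtain ⟨k, hk⟩ := hle
      exact ⟨k * (a * b * c).factorization pp, by rw [hk]; ring⟩
  · -- the integer cells at every label `j = i + 1 ≤ (l − 1)/2`: `e·⌊(j²mv − j(e−1) − (j+1))/e⌋ + (j+1) ≤ j(1−m) ≤ 0 ≤ mv`
    haveI : Fact (pp : ℕ).Prime := ⟨pp.2⟩
    obtain ⟨x, hx⟩ := hpp
    obtain ⟨hdvd, h2, hl, h30, hv1, hv2, hpole, hpos, hle, h30e⟩ := hfacts pp x hx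
    have hi : (i : ℕ) < (l - 1) / 2 := hlstar ▸ i.isLt
    obtain ⟨m, hm⟩ := hle
    set v := (a * b * c).factorization pp with hv
    have hm1 : 1 ≤ m := by
      rcases Nat.eq_zero_or_pos m with h0 | h0
      · rw [hm, h0, mul_zero] at hpos; exact absurd hpos (lt_irrefl 0)
      · exact h0
    have hP : eF pp * (2 * v) / (2 * l) = m * v :=
      Nat.div_eq_of_eq_mul_left (by omega) (by rw [hm]; ring)
    rw [hP]
    have hD : ((eF pp - 1 : ℕ) : ℤ) = (eF pp : ℤ) - 1 := by omega
    rw [hD]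
    have hem : (eF pp : ℤ) = (l : ℤ) * m := by exact_mod_cast hm
    rw [hem]
    push_cast
    rw [show ((i : ℕ) : ℤ) + 2 = ((i : ℕ) : ℤ) + 1 + 1 by ring]
    simp only [mul_one]
    -- abbreviations: `j = i + 1`, the numerator `Nn`
    set j : ℤ := ((i : ℕ) : ℤ) + 1 with hj
    have hj1 : (1 : ℤ) ≤ j := by simp [hj]
    have hjl : 2 * j ≤ (l : ℤ) - 1 := by
      have h1 : 2 * ((i : ℕ) + 1) ≤ l - 1 := by omega
      have h2' : ((2 * ((i : ℕ) + 1) : ℕ) : ℤ) ≤ ((l - 1 : ℕ) : ℤ) := by exact_mod_cast h1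
      have h3' : ((l - 1 : ℕ) : ℤ) = (l : ℤ) - 1 := by omega
      push_cast at h2'
      linarith
    have hv1' : (1 : ℤ) ≤ (v : ℤ) := by exact_mod_cast hv1
    have hv2' : (v : ℤ) ≤ 2 := by exact_mod_cast hv2
    have hm1' : (1 : ℤ) ≤ (m : ℤ) := by exact_mod_cast hm1
    have hl0 : (0 : ℤ) < (l : ℤ) * m := by
      have : (0 : ℤ) < (l : ℤ) := by exact_mod_cast (show 0 < l by omega)
      positivity
    set Nn : ℤ := j ^ 2 * ((m : ℤ) * v) - j * ((l : ℤ) * m - 1) - (j + 1) with hNn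
    have hq : (l : ℤ) * m * (Nn / ((l : ℤ) * m)) ≤ Nn := by
      have := Int.ediv_mul_le Nn hl0.ne'
      linarith [mul_comm ((l : ℤ) * m) (Nn / ((l : ℤ) * m))]
    -- `j·v ≤ l − 1`, hence `j²·m·v ≤ j·m·(l − 1)`; and `j·(1 − m) ≤ 0 ≤ m·v`
    have hjv : j * v ≤ (l : ℤ) - 1 := by nlinarith
    have hjm0 : (0 : ℤ) ≤ j * m := by positivity
    have hkey : j * m * (j * v) ≤ j * m * ((l : ℤ) - 1) := mul_le_mul_of_nonneg_left hjv hjm0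
    have hjm1 : (0 : ℤ) ≤ j * ((m : ℤ) - 1) := mul_nonneg (by linarith) (by linarith)
    have hmv : (0 : ℤ) ≤ (m : ℤ) * v := by positivity
    have hN' : Nn = j ^ 2 * ((m : ℤ) * v) - j * ((l : ℤ) * m - 1) - (j + 1) := hNn
    linarith [hq, hkey, hjm1, hmv, hN']

end Summit.ABC.IUTFork.Conditional

end
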